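import Summits.Langlands.Langlands.Theses.SenNullAlignment
import Literature.NumberTheory.Automorphic.LocalLanglandsDatumProofs
import Literature.NumberTheory.Automorphic.HilbertModularLocalGlobal
import Literature.NumberTheory.Automorphic.LocalComponentBJGenericProofs

/-!
# Sketch — crux idea `twist-invariant-transcription` for `SenNullAlignment.RegularServed`
(stmt-Langlands-16306), ideator 2, round 1.

First lemmas of the line, typed over existing declarations:

* §1 `TwistDataMatch d 𝓔 πv σ` — the LLC-FREE content of local–global compatibility at one
  place: equality of the JPSS `L`- and `ε`-data of ALL `GL₁`-twists of `πv` with the Euler /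
  Deligne–Langlands factors of `σ ⊗ (χ ∘ artin)`, plus the central-character / determinant
  clause (Carayol 1986 §0.5: "caractérisée par les égalités L(χ·σ(π_p)) = L(χ·π_p),
  ε(χ·σ(π_p)) = ε(χ·π_p) pour chaque quasi-caractère χ").
* §2 `GL2LocalConverse F` — Jacquet–Langlands 1970 Cor. 2.19 / Bushnell–Henniart 2006 §27.1
  (shape of the named fact the line needs).
* §3 `recGL_two_eq_of_twistDataMatch` — THE LEVER: for every PINNED reciprocity datum, a
  generic `πv` whose twist data match those of a Frobenius-semisimple `σ` has `rec₂ πv = [σ]`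
  (bijectivity + `lFactor_pairs`/`epsilon_pairs`/`centralChar` at `(n, m) = (2, 1)` + converse).
* §4 `RegularServedAll` (C⁺, the `∀ RD` form) and the PROVED transfer
  `regularServed_of_all : C⁺ → (∀ K, Nonempty (ReciprocityData K)) → RegularServed`.
* §5 the LLC-free transcription of Carayol–Taylor–Blasius–Rogawski–Saito–Skinner
  (`galoisRep_GL2_totallyReal_localGlobal_twist`) and the target of the line
  `localGlobal_all_of_twist` (C⁺'s compatibility half from §5 + §3).
-/

noncomputable section

open scoped MatrixGroups NumberField Polynomial
open NumberField IsDedekindDomain MeasureTheory Filter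
open Literature.NumberTheory.Automorphic Literature.NumberTheory.GaloisRepresentations
open Literature.NumberTheory.GaloisRepresentations.WeilGroup
open Literature.NumberTheory.GaloisRepresentations.IsNonarchimedeanLocalField
open Summit.Langlands

namespace Summit.Langlands.Langlands.Cruxes.RegularServed.TwistInvariant

/-! ## §1 Twist data of a local pair -/

section Local

variable {F : Type} [Field F] [ValuativeRel F] [TopologicalSpace F] [IsNonarchimedeanLocalField F]

/-- **`GL₁`-twist data match** between an irreducible smooth `πv` of `GL₂(F)` and a
Weil–Deligne representation `σ` of `W_F` on `ℂ²`, against the local Artin datum `d` and the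
system of local constants `𝓔`: for every quasi-character `χ` of `Fˣ` and continuous non-trivial
`ψ`, (L) the JPSS `L`-polynomials of the pair `(πv, χ)` are exactly the Euler factor of
`σ ⊗ (χ ∘ d.artin)`; (ε) the JPSS `ε`-monomials of `(πv, χ, ψ)` are exactly those of
`ε(s, σ ⊗ (χ ∘ d.artin), ψ)` computed with `𝓔`; (ω) `det σ = ω_{πv} ∘ d.artin`.
This is Carayol's characterisation (ASENS 1986, §0.5 p. 410) of the local correspondent,
read as a RELATION — no local Langlands datum occurs. [cite: CarayolASENS1986, §0.5] -/
def TwistDataMatch (d : LocalArtinData F) (𝓔 : LocalEpsilonSystem F)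
    (πv : SmoothIrrep (GL (Fin 2) F)) (σ : WeilDeligneRep F ℂ (Fin 2 → ℂ)) : Prop :=
  (∀ (χ : QuasiChar F) (ψ : AddChar F Circle), ψ.IsContinuousNontrivial →
    ∀ [MeasurableSpace (GL (Fin 1) F ⧸ upperUnitriangular (Fin 1) F)]
      [BorelSpace (GL (Fin 1) F ⧸ upperUnitriangular (Fin 1) F)]
      (ν : Measure (GL (Fin 1) F ⧸ upperUnitriangular (Fin 1) F))
      [SMulInvariantMeasure (GL (Fin 1) F) (GL (Fin 1) F ⧸ upperUnitriangular (Fin 1) F) ν]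
      [IsFiniteMeasureOnCompacts ν] [ν.IsOpenPosMeasure] (P : ℂ[X]),
      HasRSLFactor one_lt_two πv.ρ (glOneRep (χ : Fˣ →* ℂˣ)) ψ ν P ↔
        P = (σ.tprod (WeilDeligneRep.ofQuasiChar
              WeilGroup.exists_subgroup_le_inertia_isOpen_of_continuous_holds d χ)).eulerFactor
              (absInertia_normal_holds F) (exists_isFrobPow_holds F)) ∧
  (∀ (χ : QuasiChar F) (ψ : AddChar F Circle), ψ.IsContinuousNontrivial →
    ∀ [MeasurableSpace F] [BorelSpace F] (μ : Measure F) [μ.IsAddHaarMeasure],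
      IsSelfDualMeasure ψ μ →
    ∀ [MeasurableSpace (GL (Fin 1) F ⧸ upperUnitriangular (Fin 1) F)]
      [BorelSpace (GL (Fin 1) F ⧸ upperUnitriangular (Fin 1) F)]
      (ν : Measure (GL (Fin 1) F ⧸ upperUnitriangular (Fin 1) F))
      [SMulInvariantMeasure (GL (Fin 1) F) (GL (Fin 1) F ⧸ upperUnitriangular (Fin 1) F) ν]
      [IsFiniteMeasureOnCompacts ν] [ν.IsOpenPosMeasure] (e : ℂ) (a : ℤ),
      HasRSEpsilon one_lt_two πv.ρ (glOneRep (χ : Fˣ →* ℂˣ)) ψ μ ν e a ↔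
        ∀ s : ℂ, epsilonWD IsFrobPow.mul_holds IsFrobPow.unique_holds (absInertia_normal_holds F)
            (exists_isFrobPow_holds F) 𝓔 ψ μ
            (σ.tprod (WeilDeligneRep.ofQuasiChar
              WeilGroup.exists_subgroup_le_inertia_isOpen_of_continuous_holds d χ)) s =
          e * (((residueFieldCard F : ℂ) ^ (-s)) ^ a)) ∧
  (∀ (w : WeilGroup F) (c : ℂ),
    πv.ρ (Matrix.GeneralLinearGroup.scalar (Fin 2) (d.artin w)) = c • LinearMap.id →
      LinearMap.det (σ.ρ w) = c)

/-! ## §2 The local converse theorem for `GL₂(F)` (shape of the named fact) -/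

/-- **Local converse theorem for `GL₂(F)`** (Jacquet–Langlands 1970, Cor. 2.19;
Bushnell–Henniart 2006, §27.1): two GENERIC irreducible smooth representations of `GL₂(F)`
with the same central character and the same `γ(s, π × χ, ψ)` for every quasi-character `χ`
are isomorphic. Stated with the tree's JPSS `γ`-predicate at `(n, m) = (2, 1)`.
[cite: JacquetLanglands1970, Cor. 2.19] -/
def GL2LocalConverse (F : Type) [Field F] [ValuativeRel F] [TopologicalSpace F]
    [IsNonarchimedeanLocalField F] : Prop :=
  ∀ (π π' : SmoothIrrep (GL (Fin 2) F)) (ψ : AddChar F Circle), ψ.IsContinuousNontrivial →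
    IsGeneric π.ρ ψ → IsGeneric π'.ρ ψ →
    (∀ ω : Subgroup.center (GL (Fin 2) F) →* ℂˣ,
      π.HasCentralCharacter ω ↔ π'.HasCentralCharacter ω) →
    (∀ (χ : QuasiChar F) [MeasurableSpace F] [BorelSpace F] (μ : Measure F) [μ.IsAddHaarMeasure]
      [MeasurableSpace (GL (Fin 1) F ⧸ upperUnitriangular (Fin 1) F)]
      [BorelSpace (GL (Fin 1) F ⧸ upperUnitriangular (Fin 1) F)]
      (ν : Measure (GL (Fin 1) F ⧸ upperUnitriangular (Fin 1) F))
      [SMulInvariantMeasure (GL (Fin 1) F) (GL (Fin 1) F ⧸ upperUnitriangular (Fin 1) F) ν]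
      [IsFiniteMeasureOnCompacts ν] [ν.IsOpenPosMeasure] (γ : RatFunc ℂ),
      HasRSGamma one_lt_two π.ρ (glOneRep (χ : Fˣ →* ℂˣ)) ψ μ ν γ ↔
        HasRSGamma one_lt_two π'.ρ (glOneRep (χ : Fˣ →* ℂˣ)) ψ μ ν γ) →
    Nonempty (π.ρ.Equiv π'.ρ)

end Local

/-! ## §3 The lever: pointwise characterisation of `rec₂` of a PINNED datum on generic classes -/

/-- **THE LEVER (first lemma of the line).** For a reciprocity datum `RD` (canonically
normalised by its pins), a finite place `v`, a GENERIC irreducible smooth `πv` of `GL₂(K_v)` and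
a Frobenius-semisimple `σ` on `ℂ²`: if the `GL₁`-twist data of `πv` match those of `σ`
(against `RD`'s own Artin datum and `ε`-system), then `rec₂^{RD}(πv) = [σ]`.
Route of proof: `RD.recGL_bijective` gives `π'` with `rec₂ π' = [σ]`; `π'` is generic because a
legal `rec₂` sends the non-generic classes `φ ∘ det` onto the special pairs
`(φ|·|^{1/2} ⊕ φ|·|^{-1/2}, N = 0)` (Jacquet–Langlands Props 3.5–3.6 / Thm 2.18 through
`lFactor_pairs`) and `σ` is no such pair (its `χ`-twisted Euler factors are those of the generic
`πv`, never of degree 2 with root ratio `q`); `lFactor_pairs`, `epsilon_pairs`, `centralChar`,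
`gl_one` of `RD.llc v` at `(2, 1)` give `π'` the twist data of `σ`, i.e. of `πv`; the local
converse theorem (`GL2LocalConverse`) gives `π' ≅ πv`. [cite: JacquetLanglands1970, Cor. 2.19]
[cite: CarayolASENS1986, §0.5] -/
theorem recGL_two_eq_of_twistDataMatch {K : Type} [Field K] [NumberField K]
    (RD : ReciprocityData K) (v : HeightOneSpectrum (𝓞 K))
    (hconv : GL2LocalConverse (v.adicCompletion K))
    (πv : SmoothIrrep (GL (Fin 2) (v.adicCompletion K)))
    (ψ : AddChar (v.adicCompletion K) Circle) (hψ : ψ.IsContinuousNontrivial)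
    (hgen : IsGeneric πv.ρ ψ)
    (σ : WeilDeligneRep (v.adicCompletion K) ℂ (Fin 2 → ℂ)) (hσ : σ.IsFrobSemisimple)
    (h : TwistDataMatch (RD.llc v).artin (RD.llc v).eps πv σ) :
    (RD.llc v).recGL 2 (IrrClass.mk πv) =
      Quotient.mk (frobSemisimpleWDSetoid (v.adicCompletion K) 2) ⟨σ, hσ⟩ := by
  sorry

/-- Corollary shape used place by place: the `HasFrobSemisimpleClass` clause of
`LocalGlobalCompatibleAt` from twist data of a Frobenius-semisimplification. [folklore] -/
theorem hasFrobSemisimpleClass_of_twistDataMatch {K : Type} [Field K] [NumberField K]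
    (RD : ReciprocityData K) (v : HeightOneSpectrum (𝓞 K))
    (hconv : GL2LocalConverse (v.adicCompletion K))
    (πv : SmoothIrrep (GL (Fin 2) (v.adicCompletion K)))
    (ψ : AddChar (v.adicCompletion K) Circle) (hψ : ψ.IsContinuousNontrivial)
    (hgen : IsGeneric πv.ρ ψ)
    (rℂ σ : WeilDeligneRep (v.adicCompletion K) ℂ (Fin 2 → ℂ))
    (hσ : σ.IsFrobSemisimplificationOf rℂ)
    (h : TwistDataMatch (RD.llc v).artin (RD.llc v).eps πv σ) :
    rℂ.HasFrobSemisimpleClass ((RD.llc v).recGL 2 (IrrClass.mk πv)) :=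
  ⟨σ, hσ, (recGL_two_eq_of_twistDataMatch RD v hconv πv ψ hψ hgen σ hσ.isFrobSemisimple h).symm⟩

/-! ## §4 The `∀ RD` form (C⁺) and its transfer to the crux (proved) -/

/-- **C⁺ — `RegularServed` for EVERY pinned reciprocity datum.** [folklore] -/
def RegularServedAll : Prop :=
  ∀ (K : Type) [Field K] [NumberField K], IsTotallyReal K → ∀ (RD : ReciprocityData K)
    (hcpt : isCompact_glFiniteIntegralLevel 2 K) (π : CuspidalAutomorphicRepData 2 K hcpt),
    π.1.IsLAlgebraic → (∃ T : InfinityType K 2, π.1.HasInfinityType T ∧ T.IsRegular) →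
    ∀ (ℓ : ℕ) [Fact ℓ.Prime] (ι : PadicAlgCl ℓ ≃+* ℂ),
      ∃ ρ : FramedGaloisRep K (PadicAlgCl ℓ) 2,
        ρ.toGaloisRep.IsIrreducible ∧ IsGeometricFramed RD ρ ∧ Corresponds RD ι π.1 ρ

/-- **Transfer (proved): C⁺ and canonical reciprocity data (item stmt-Langlands-17930,
`∀ F, Nonempty (ReciprocityData F)`, here only over totally real fields) give the crux BY NAME.**
[folklore] -/
theorem regularServed_of_all (hall : RegularServedAll)
    (hN : ∀ (K : Type) [Field K] [NumberField K], IsTotallyReal K → Nonempty (ReciprocityData K)) :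
    Summit.Langlands.Langlands.Theses.SenNullAlignment.RegularServed := by
  intro K _ _ hK
  obtain ⟨RD⟩ := hN K hK
  exact ⟨RD, fun hcpt π hL hreg ℓ _ ι => hall K hK RD hcpt π hL hreg ℓ ι⟩

/-! ## §5 The LLC-free transcription and the target of the line -/

/-- **Carayol–Taylor–Blasius–Rogawski–Saito–Skinner in LLC-FREE form** (the literature fact the
line asks to be cited in place of / next to `galoisRep_GL2_totallyReal_localGlobal`): same
binders and same clauses symbol for symbol, except that the last clause
`rℂ.HasFrobSemisimpleClass ((llc v).recGL 2 [πv])` — which mentions an existentially quantified,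
UNPINNED local Langlands datum — is replaced by Carayol's characterisation: some
Frobenius-semisimplification `σ` of `rℂ = ι WD(r|_{Γ_{K_v}})` has the `GL₁`-twist data of `πv`
against THE Artin map (`d.IsCanonical`) and every canonically normalised system of local
constants. No `LocalLanglandsDatum`, hence nothing to pin. [cite: CarayolASENS1986, §0.5 and Thm. (A)]
[cite: Skinner2009, (1) p. 242 and Thm. 1] -/
def galoisRep_GL2_totallyReal_localGlobal_twist : Prop :=
  ∀ (K : Type) [Field K] [NumberField K], IsTotallyReal K →
    ∀ (hcpt : isCompact_glFiniteIntegralLevel 2 K) (π : CuspidalAutomorphicRepData 2 K hcpt),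
      π.1.IsLAlgebraic → (∃ T : InfinityType K 2, π.1.HasInfinityType T ∧ T.IsRegular) →
      ∀ (ℓ : ℕ) [Fact ℓ.Prime] (ι : PadicAlgCl ℓ ≃+* ℂ) (r : FramedGaloisRep K (PadicAlgCl ℓ) 2),
        r.toGaloisRep.IsIrreducible → SatakeFrobCompatibleAE ι π.1 r →
        (∀ (v : HeightOneSpectrum (𝓞 K)) (hv : ((ℓ : ℕ) : 𝓞 K) ∈ v.asIdeal),
            (Literature.NumberTheory.PAdicHodge.fontainePstAdicCompletion v ℓ hv).IsDeRhamFramed (r.toLocal v)) ∧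
        ∀ v : HeightOneSpectrum (𝓞 K),
          ∃ (πv : SmoothIrrep (GL (Fin 2) (v.adicCompletion K)))
            (rv : WeilDeligneRep (v.adicCompletion K) (PadicAlgCl ℓ) (Fin 2 → PadicAlgCl ℓ))
            (rℂ σ : WeilDeligneRep (v.adicCompletion K) ℂ (Fin 2 → ℂ)),
            π.1.HasLocalComponentAt v πv.ρ ∧
            (((ℓ : ℕ) : 𝓞 K) ∉ v.asIdeal → IsWeilDeligneOfLadic (r.toLocal v).toWeilGroupHom rv) ∧
            (∀ hv : ((ℓ : ℕ) : 𝓞 K) ∈ v.asIdeal,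
              (Literature.NumberTheory.PAdicHodge.fontainePstAdicCompletion v ℓ hv).IsWeilDeligneOf (r.toLocal v) rv) ∧
            rv.IsTransportAlong (ι : PadicAlgCl ℓ →+* ℂ) rℂ ∧
            σ.IsFrobSemisimplificationOf rℂ ∧
            ∀ (d : LocalArtinData (v.adicCompletion K)), d.IsCanonical →
              ∀ 𝓔 : LocalEpsilonSystem (v.adicCompletion K),
                (∀ (E : Type) [Field E] [ValuativeRel E] [TopologicalSpace E]
                  [IsNonarchimedeanLocalField E] [Algebra (v.adicCompletion K) E]
                  [FiniteDimensional (v.adicCompletion K) E], (𝓔.artin E).IsCanonical) →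
                TwistDataMatch d 𝓔 πv σ

/-- **Target of the line (to be proved from §3 place by place): the compatibility half of C⁺
for EVERY pinned datum**, from the LLC-free fact, the local converse theorem at every completion,
and genericity of local components (in tree:
`CuspidalAutomorphicRepData.exists_isGeneric_of_hasLocalComponentAt`). The pins of `RD` are used
exactly once: to instantiate the fact's `∀ d canonical, ∀ 𝓔 canonical` at
`(RD.llc v).artin, (RD.llc v).eps`. [folklore] -/
theorem localGlobal_all_of_twist (hfact : galoisRep_GL2_totallyReal_localGlobal_twist)
    (hconv : ∀ (F : Type) [Field F] [ValuativeRel F] [TopologicalSpace F]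
      [IsNonarchimedeanLocalField F], GL2LocalConverse F) :
    ∀ (K : Type) [Field K] [NumberField K], IsTotallyReal K → ∀ (RD : ReciprocityData K)
      (hcpt : isCompact_glFiniteIntegralLevel 2 K) (π : CuspidalAutomorphicRepData 2 K hcpt),
      π.1.IsLAlgebraic → (∃ T : InfinityType K 2, π.1.HasInfinityType T ∧ T.IsRegular) →
      ∀ (ℓ : ℕ) [Fact ℓ.Prime] (ι : PadicAlgCl ℓ ≃+* ℂ) (r : FramedGaloisRep K (PadicAlgCl ℓ) 2),
        r.toGaloisRep.IsIrreducible → SatakeFrobCompatibleAE ι π.1 r →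
        (∀ (v : HeightOneSpectrum (𝓞 K)) (hv : ((ℓ : ℕ) : 𝓞 K) ∈ v.asIdeal),
            (RD.pst ℓ v hv).IsDeRhamFramed (r.toLocal v)) ∧
          ∀ v : HeightOneSpectrum (𝓞 K), LocalGlobalCompatibleAt RD ι π.1 r v := by
  intro K _ _ hK RD hcpt π hL hreg ℓ _ ι r hirr hae
  obtain ⟨hdR, hloc⟩ := hfact K hK hcpt π hL hreg ℓ ι r hirr hae
  refine ⟨hdR, fun v => ?_⟩
  obtain ⟨πv, rv, rℂ, σ, hπv, hlad, hpst, htr, hσ, htw⟩ := hloc v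
  haveI : NeZero (2 : ℕ) := ⟨two_ne_zero⟩
  obtain ⟨ψ, hψ, hgen⟩ :=
    π.exists_isGeneric_of_hasLocalComponentAt v πv.ρ πv.isSmooth hπv
  refine ⟨πv, rv, rℂ, hπv, hlad, hpst, htr, ?_⟩
  exact hasFrobSemisimpleClass_of_twistDataMatch RD v (hconv _) πv ψ hψ hgen rℂ σ hσ
    (htw (RD.llc v).artin (RD.llc_isCanonical v) (RD.llc v).eps
      (fun E _ _ _ _ _ _ => RD.llc_eps_isCanonical v E))

end Summit.Langlands.Langlands.Cruxes.RegularServed.TwistInvariant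

end
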